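import Summits.QuantumFields.BalabanUV.T4Continuum.Support.GradedWellSliceCoercive
import Summits.QuantumFields.BalabanUV.T4Continuum.Support.GradedWellTowerAssembly

/-!
# T⁴ programme, spine node NE2 (U1a), sub-row Δ1 — graded well: THE JUNCTION (GW-W1) + (GW-S0) ⟹ `hco` — the coercivity binder of the
# torus transfer / tower assembly DISCHARGED; the graded-well tower ENDs now display ONLY `‖E_GW‖ ≤ e` and the two-level leaf (GW-E)

NE2 formalisation swarm `b2b-balaban-t4-ne2-formalise-*`, leaf 09 (gen 11).  R49 (a) (journal 2026-08-21 l.25771): «the graded-well `hinjK`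
needs exactly: (GW-W1) + (GW-S0) ⟹ γ; ‖E‖ ≤ e level-free; and ONE two-level leaf (GW-E)».  With (GW-W1) landed
(`GradedWellSliceCoercive.sliceCoercive_GW`, this lineage) and (GW-S0) landed (owner's `GradedWellScalarCoercive`), the coercivity
`γGW = min(cGW/2, 1/(2γ_GW⁻¹))` of `regionGW` holds at EVERY level (`GradedWellSliceCoercive.coercive_regionGW`), so the binder
`hco : ∀ k, m ≤ k → Coercive (regionGW …) γ` of the owner's `GradedWellTorusTransfer.hinjK_GW_of_torus` and of leaf-06-g8's
`GradedWellTowerAssembly.freeTowerLaws_GW_of_torus` / `towerLimitRate_GW_of_torus` / `towerLimitRate_GW_perturbed` is INHABITED BY NAME.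
This file is that one-line junction ([folklore] bookkeeping, 0 sorry): `gamGWv`/`gamGWv_pos` (the constant), **`hco_GW`**,
**`hinjK_GW_of_torus_coercive`**, **`freeTowerLaws_GW_coercive`**, **`towerLimitRate_GW_coercive`**, **`towerLimitRate_GW_perturbed_coercive`** —
each = the named END with `γ := gamGWv d L m a a′` and `hco` supplied; displayed REMAIN: `hE` (`‖E_GW(k)‖ ≤ e`, level-free bookkeeping) and
`hEc` (= (GW-E): `‖E_GW(k+1)·J_k − J_k·E_GW(k)‖ ≤ Ce·θ^k`), plus `2 ≤ L`, `layer ≤ m`, `0 < a`, `0 < a′`, `L⁻¹ ≤ θ < 1`.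

HONEST FRAMING (T4-DAG p. 1).  Model level (`U = 1`, one layer map on unit blocks, `m` fixed, finite torus, operator norm); [folklore];
(GW-E) and `‖E_GW‖ ≤ e` are DISPLAYED, not proved; NOT a statement about Bałaban's multi-region kernels; NE2 (U1a) NOT proved; spine PROVED
0/9 unchanged; NOT [B9] (3.16)/(3.23)–(3.27)/(3.42) as printed; NOT infinite volume / mass gap / Clay.  HONEST DEPENDENCY: continuum YM on T⁴
⇐ BetaPertH ∧ nine spine estimates (0/9 proved); BetaPertH ⇐ (D1) ∧ (D4) ∧ CAP+tail; G-an2-4 gates asym, D1 and NE2/3/4.  No `sorry`.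
-/

noncomputable section

open scoped BigOperators ComplexConjugate Matrix Matrix.Norms.L2Operator

namespace Summit.QuantumFields.BalabanUV.T4Continuum.GradedWellTowerCoercive

open Literature.MathematicalPhysics.QuantumFieldTheory.Balaban1983to89.B5Prop11Plancherel (Tor fine Cst)
open Literature.MathematicalPhysics.QuantumFieldTheory.Balaban1983to89.B5G183RateUnitTower (lev lev_neZero)
open Summit.QuantumFields.BalabanUV.T4Continuum
open Summit.QuantumFields.BalabanUV.T4Continuum.CovariantAveragingTower (TowerLimitRate)
open Summit.QuantumFields.BalabanUV.T4Continuum.BackgroundResolventTower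
open Summit.QuantumFields.BalabanUV.T4Continuum.BalabanAveragedTowerUnit (idx Qlev)
open Summit.QuantumFields.BalabanUV.T4Continuum.SubtypeCompression (Coercive)
open Summit.QuantumFields.BalabanUV.T4Continuum.KingPairingPlantedLaw (JpcT)
open Summit.QuantumFields.BalabanUV.T4Continuum.GradedWellData
open Summit.QuantumFields.BalabanUV.T4Continuum.GradedWellScalarCoercive (gamGW gamGW_pos)
open Summit.QuantumFields.BalabanUV.T4Continuum.GradedWellTorusTransfer (EGW C1T hinjK_GW_of_torus)
open Summit.QuantumFields.BalabanUV.T4Continuum.GradedWellTowerAssembly (freeTowerLaws_GW_of_torus towerLimitRate_GW_of_torus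
  towerLimitRate_GW_perturbed)
open Summit.QuantumFields.BalabanUV.T4Continuum.GradedWellSliceCoercive (cGW cGW_pos coercive_regionGW)

variable {d : ℕ} (L : ℕ) [NeZero L] (M : Fin d → ℕ) [hM : ∀ μ, NeZero (M μ)] (m : ℕ) (layer : Tor M → ℕ) (a a' : ℝ)

/-- **THE COERCIVITY CONSTANT OF THE GRADED WELL**: `γGW = min(cGW/2, 1/(2·γ_GW⁻¹))` (depends on `d, L, m, a, a′` only). [folklore] -/
def gamGWv (d L m : ℕ) (a a' : ℝ) : ℝ := min (cGW d L m a a' / 2) (1 / (2 * (gamGW d m a')⁻¹))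

omit hM in
/-- `0 < γGW`. [folklore] -/
theorem gamGWv_pos (ha' : 0 < a') : 0 < gamGWv d L m a a' := by
  unfold gamGWv
  have h1 := cGW_pos (d := d) L (m := m) a a' ha'
  have h2 := gamGW_pos (d := d) (m := m) a' ha'
  exact lt_min (by positivity) (by positivity)

/-- **`hco` INHABITED**: `∀ k, Coercive (regionGW L M k m layer a a′) γGW` — (GW-W1) + (GW-S0), every level (the `m ≤ k` guard of the
consumers is not even needed). [cite: Balaban1985BackgroundPropagators, (3.27) p.395 (shape: existence of G)] [folklore] -/
theorem hco_GW (ha : 0 < a) (hL : 2 ≤ L) (hlay : ∀ y, layer y ≤ m) (ha' : 0 < a') (k : ℕ) (_hk : m ≤ k) :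
    Coercive (regionGW L M k m layer a a') (gamGWv d L m a a') :=
  coercive_regionGW L M k m layer a a' hL hlay ha ha'

/-- **KING's INJECTED LAW OF THE GRADED-WELL PROPAGATORS, `hco` DISCHARGED** (owner's `hinjK_GW_of_torus` BY NAME): displayed remain
`hE` and (GW-E) `hEc`. [cite: King1986, Thm 2.2 (2.14) p.654 (shape: injected law)] [folklore] -/
theorem hinjK_GW_of_torus_coercive (ha : 0 < a) (hL : 2 ≤ L) (hlay : ∀ y, layer y ≤ m) (ha' : 0 < a') {e θ Ce : ℝ} (he : 0 ≤ e) (hθ : (L : ℝ)⁻¹ ≤ θ)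
    (hE : ∀ k, m ≤ k → ‖EGW L M k m layer a a' ha‖ ≤ e)
    (hEc : ∀ k, m ≤ k → ‖EGW L M (k + 1) m layer a a' ha * JpcT L M k - JpcT L M k * EGW L M k m layer a a' ha‖ ≤ Ce * θ ^ k)
    (k : ℕ) (hk : m ≤ k) :
    ‖(regionGW L M (k + 1) m layer a a')⁻¹ * JpcT L M k - JpcT L M k * (regionGW L M k m layer a a')⁻¹‖
      ≤ C1T d a (gamGWv d L m a a') e Ce * θ ^ k :=
  hinjK_GW_of_torus L M m layer a a' ha (gamGWv_pos (d := d) L (m := m) a a' ha') he hθ (hco_GW L M m layer a a' ha hL hlay ha') hE hEc k hk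

/-- **THE `U = 1` FREE-TOWER BUNDLE OF THE GRADED WELL, `hco` DISCHARGED** (leaf-06-g8's `freeTowerLaws_GW_of_torus` BY NAME). [folklore] -/
theorem freeTowerLaws_GW_coercive (ha : 0 < a) (hL : 2 ≤ L) (hlay : ∀ y, layer y ≤ m) (ha' : 0 < a') {e θ Ce : ℝ} (he : 0 ≤ e) (hθ : (L : ℝ)⁻¹ ≤ θ)
    (hE : ∀ k, m ≤ k → ‖EGW L M k m layer a a' ha‖ ≤ e)
    (hEc : ∀ k, m ≤ k → ‖EGW L M (k + 1) m layer a a' ha * JpcT L M k - JpcT L M k * EGW L M k m layer a a' ha‖ ≤ Ce * θ ^ k) :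
    FreeTowerLaws (ι := fun k => idx L M (m + k)) (fun k => regionGW L M (m + k) m layer a a') (fun k => Qlev L M (m + k))
      (fun k => JpcT L M (m + k)) (fun _ => 0) ((L : ℝ) ^ d)
      (fun k => (1 + (gamGWv d L m a a')⁻¹ * e) * (2 * d * Cst d a * ((L : ℝ)⁻¹) ^ (m + k)))
      (fun k => C1T d a (gamGWv d L m a a') e Ce * θ ^ (m + k)) (fun _ => 0) :=
  freeTowerLaws_GW_of_torus L M m layer a a' ha (gamGWv_pos (d := d) L (m := m) a a' ha') he hθ (hco_GW L M m layer a a' ha hL hlay ha') hE hEc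

/-- **(GW-A) THE KING-AVERAGED GRADED-WELL PROPAGATORS CONVERGE, `hco` DISCHARGED** (leaf-06-g8's `towerLimitRate_GW_of_torus` BY NAME):
for `2 ≤ L`, `layer ≤ m`, `0 < a`, `0 < a′`, `L⁻¹ ≤ θ < 1`, MODULO ONLY `hE` (‖E_GW‖ ≤ e) and `hEc` ((GW-E)).
[cite: King1986, Thm 2.2 p.654 (shape: convergence of averaged propagators)] [folklore] -/
theorem towerLimitRate_GW_coercive (ha : 0 < a) (hL : 2 ≤ L) (hlay : ∀ y, layer y ≤ m) (ha' : 0 < a') {e θ Ce : ℝ} (he : 0 ≤ e)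
    (hθ : (L : ℝ)⁻¹ ≤ θ) (hθ1 : θ < 1)
    (hE : ∀ k, m ≤ k → ‖EGW L M k m layer a a' ha‖ ≤ e)
    (hEc : ∀ k, m ≤ k → ‖EGW L M (k + 1) m layer a a' ha * JpcT L M k - JpcT L M k * EGW L M k m layer a a' ha‖ ≤ Ce * θ ^ k) :
    TowerLimitRate (ι := fun k => idx L M (m + k)) (fun k => Qlev L M (m + k)) ((L : ℝ) ^ d)
      (fun k => (regionGW L M (m + k) m layer a a')⁻¹)
      (Cpert 0 ((1 + (gamGWv d L m a a')⁻¹ * e) * (2 * d * Cst d a) * θ ^ m) (C1T d a (gamGWv d L m a a') e Ce * θ ^ m) 0 0 0) θ :=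
  towerLimitRate_GW_of_torus L M m layer a a' ha (gamGWv_pos (d := d) L (m := m) a a' ha') he hθ hθ1 (hco_GW L M m layer a a' ha hL hlay ha')
    hE hEc

/-- **… AND FOR ANY PERTURBATION FAMILY ON THE RE-BASED TOWER** (leaf-06-g8's `towerLimitRate_GW_perturbed` BY NAME, `hco` discharged).
[folklore] -/
theorem towerLimitRate_GW_perturbed_coercive (ha : 0 < a) (hL : 2 ≤ L) (hlay : ∀ y, layer y ≤ m) (ha' : 0 < a') {e θ Ce : ℝ} (he : 0 ≤ e)
    (hθ : (L : ℝ)⁻¹ ≤ θ) (hθ1 : θ < 1)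
    (hE : ∀ k, m ≤ k → ‖EGW L M k m layer a a' ha‖ ≤ e)
    (hEc : ∀ k, m ≤ k → ‖EGW L M (k + 1) m layer a a' ha * JpcT L M k - JpcT L M k * EGW L M k m layer a a' ha‖ ≤ Ce * θ ^ k)
    {P : (k : ℕ) → Matrix (idx L M (m + k)) (idx L M (m + k)) ℂ} {κ C₂ : ℝ}
    (hpert : PerturbationLaws (ι := fun k => idx L M (m + k)) (fun k => regionGW L M (m + k) m layer a a') P
      (fun k => JpcT L M (m + k)) κ (fun k => C₂ * θ ^ k)) {t : ℂ} (ht : ‖t‖ * κ < 1) :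
    TowerLimitRate (ι := fun k => idx L M (m + k)) (fun k => Qlev L M (m + k)) ((L : ℝ) ^ d)
      (fun k => (regionGW L M (m + k) m layer a a' + t • P k)⁻¹)
      (Cpert κ ((1 + (gamGWv d L m a a')⁻¹ * e) * (2 * d * Cst d a) * θ ^ m) (C1T d a (gamGWv d L m a a') e Ce * θ ^ m) C₂ 0 t) θ :=
  towerLimitRate_GW_perturbed L M m layer a a' ha (gamGWv_pos (d := d) L (m := m) a a' ha') he hθ hθ1 (hco_GW L M m layer a a' ha hL hlay ha')
    hE hEc hpert ht

end Summit.QuantumFields.BalabanUV.T4Continuum.GradedWellTowerCoercive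

end
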